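import Literature.AlgebraicGeometry.ShimuraVarieties.UnitaryBallGroupForms
import HarnessLib

/-!
# The lift pairing read on the ball: `liftPairing k F' F u = (1 - ‖u·x₀‖²)^{3k} · conj (F' (u·x₀)) · F (u·x₀)`

The bridge between the group-side and the ball-side Petersson integrands: the integrand
`BallForms.liftPairing k F' F` of the group-side Petersson pairing
(`UnitaryBallGroupForms`: `⟪groupLiftCM F' g, groupLiftCM F g⟫ = liftPairing k F' F (pr g⁻¹)`) is the
PULL-BACK ALONG THE ORBIT MAP `u ↦ u • x₀` of the function
`ballPairing k F' F z = (1 - ‖z‖²)^{3k} · conj (F' z) · F z` on the ball. The input is the classical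
identity `|j(g, z)|² = ((1 - ‖g z‖²) / (1 - ‖z‖²))³` for the canonical automorphy factor
`j(g, z) = det D(g)(z)` of `U(2,1)` acting on `𝔹²` (Rudin, *Function Theory in the Unit Ball of ℂⁿ*,
Thm 2.2.6 (i) with (6): `J_ℝψ(z) = ((1 - |ψ(z)|²)/(1 - |z|²))^{n+1}`, `J_ℝ = |J_ℂ|²`, here `n = 2`),
proved here in kernel from `det D(g)(z) = det g / w₂³` (`BallModel.det_Jac`), `|det g| = 1` and
`1 - ‖g z‖² = (1 - ‖z‖²)/|w₂|²` (invariance of the `(2,1)`-form `Q`).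

Main statements: `norm_det_mat_sq`, `one_sub_nsq_smul`, `norm_canonicalFactor_sq`,
`norm_canonicalFactor_x₀_sq`, `ballPairing`, `liftPairing_eq_ballPairing`,
`ballPairing_smul_of_mem` (`Δ`-invariance on the ball for factor forms), `continuous_ballPairing`.
-/

noncomputable section

open Matrix MulAction Topology ComplexConjugate
open Literature.Geometry.ComplexHyperbolic
open Literature.Geometry.ComplexHyperbolic.BallModel
open Literature.NumberTheory.Automorphic
open Literature.NumberTheory.Automorphic.AutomorphyFactor

namespace Literature.AlgebraicGeometry.ShimuraVarieties

namespace BallForms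

/-! ### `|det g| = 1` and the transformation of `1 - ‖z‖²` -/

/-- `|det g|² = 1` for `g ∈ U(2,1)` (take determinants in `gᴴ J g = J`). [folklore] -/
theorem norm_det_mat_sq (g : U21) : ‖(mat g).det‖ ^ 2 = 1 := by
  have h := congrArg Matrix.det (mat_mem g)
  rw [det_mul, det_mul, det_conjTranspose, det_J] at h
  have h1 : star (mat g).det * (mat g).det = 1 := by linear_combination -h
  have h2 : ((‖(mat g).det‖ ^ 2 : ℝ) : ℂ) = 1 := by
    rw [← h1, Complex.star_def, Complex.conj_mul']
    push_cast
    rfl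
  exact_mod_cast h2

/-- `|det g| = 1` for `g ∈ U(2,1)`. [folklore] -/
theorem norm_det_mat (g : U21) : ‖(mat g).det‖ = 1 := by
  have h := norm_det_mat_sq g
  nlinarith [norm_nonneg (mat g).det]

/-- `Q (z₀, z₁, 1) = ‖z‖² - 1`. [folklore] -/
theorem Q_lift_eq (z : Ball) : Q (lift z) = nsq z.1 - 1 := by
  simp [Q, nsq]

/-- `Q (c • w) = |c|² Q(w)`. [folklore] -/
theorem Q_smul (c : ℂ) (w : Fin 3 → ℂ) : Q (c • w) = ‖c‖ ^ 2 * Q w := by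
  simp only [Q, Pi.smul_apply, smul_eq_mul, norm_mul]
  ring

/-- `1 - ‖z‖² > 0` on the ball. [folklore] -/
theorem one_sub_nsq_pos (z : Ball) : 0 < 1 - nsq z.1 := by
  have := z.2; linarith

/-- **Transformation of `1 - ‖z‖²`**: `1 - ‖g z‖² = (1 - ‖z‖²) / |w₂|²` with `w = g · (z, 1)`
(invariance of `Q` under `U(2,1)`). [folklore] -/
theorem one_sub_nsq_smul (g : U21) (z : Ball) :
    1 - nsq (g • z).1 = (1 - nsq z.1) / ‖W3 g z 2‖ ^ 2 := by
  have hw : ‖W3 g z 2‖ ≠ 0 := norm_ne_zero_iff.mpr (W3_2_ne_zero g z)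
  have hn : (0 : ℝ) < ‖W3 g z 2‖ ^ 2 := by positivity
  have hQ : Q (lift (act g z)) = ‖(W3 g z 2)⁻¹‖ ^ 2 * Q (lift z) := by
    rw [lift_act, Q_smul]
    unfold W3
    rw [Q_mulVec (mat_mem g)]
  rw [Q_lift_eq, Q_lift_eq, norm_inv] at hQ
  rw [smul_def, eq_div_iff hn.ne']
  have hQ' : (nsq (act g z).1 - 1) * ‖W3 g z 2‖ ^ 2 = nsq z.1 - 1 := by
    rw [hQ]; field_simp
  linarith

/-- **`|j(g, z)|² = ((1 - ‖g z‖²) / (1 - ‖z‖²))³`** for the canonical factor `j(g, z) = det D(g)(z)`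
(Rudin, Thm 2.2.6 (6) with `J_ℝ = |J_ℂ|²`, `n = 2`; here from `det D(g)(z) = det g / w₂³`).
[cite: Rudin1980, Theorem 2.2.6 (i), eq. (6)] -/
theorem norm_canonicalFactor_sq (g : U21) (z : Ball) :
    ‖canonicalFactor g z‖ ^ 2 = ((1 - nsq (g • z).1) / (1 - nsq z.1)) ^ 3 := by
  have hz : (1 - nsq z.1) ≠ 0 := (one_sub_nsq_pos z).ne'
  have hw : ‖W3 g z 2‖ ≠ 0 := norm_ne_zero_iff.mpr (W3_2_ne_zero g z)
  rw [one_sub_nsq_smul, canonicalFactor, det_Jac, norm_div, norm_pow, div_pow, norm_det_mat_sq]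
  field_simp

/-- At the base point: `|j(g, x₀)|² = (1 - ‖g x₀‖²)³`. [cite: Rudin1980, Theorem 2.2.6 (i), eq. (6)] -/
theorem norm_canonicalFactor_x₀_sq (g : U21) :
    ‖canonicalFactor g x₀‖ ^ 2 = (1 - nsq (g • x₀).1) ^ 3 := by
  rw [norm_canonicalFactor_sq]
  simp [nsq]

/-! ### The pairing density on the ball -/

/-- The **Petersson pairing density on the ball** in weight `k` (canonical cocycle `jᵏ`):
`ballPairing k F' F z = (1 - ‖z‖²)^{3k} · conj (F' z) · F z` — for `k = 1` the density
`F F̄' (1 - |z|²)³` of `∫_{Γ\𝔹²} ω ∧ ω̄'` against the invariant measure `(1 - |z|²)⁻³ dV`. [folklore] -/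
def ballPairing (k : ℕ) (F' F : Ball → ℂ) (z : Ball) : ℂ :=
  (((1 - nsq z.1) ^ (3 * k) : ℝ) : ℂ) * (conj (F' z) * F z)

/-- Unfolding lemma for `ballPairing`. [folklore] -/
theorem ballPairing_apply (k : ℕ) (F' F : Ball → ℂ) (z : Ball) :
    ballPairing k F' F z = (((1 - nsq z.1) ^ (3 * k) : ℝ) : ℂ) * (conj (F' z) * F z) := rfl

/-- **The lift pairing is the pull-back of the ball density along the orbit map**:
`liftPairing k F' F u = ballPairing k F' F (u • x₀)`. [folklore] -/
theorem liftPairing_eq_ballPairing (k : ℕ) (F' F : Ball → ℂ) (u : U21) :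
    liftPairing k F' F u = ballPairing k F' F (u • x₀) := by
  have h : conj (canonicalFactor u x₀) * canonicalFactor u x₀ =
      (((1 - nsq (u • x₀).1) ^ 3 : ℝ) : ℂ) := by
    rw [Complex.conj_mul']
    exact_mod_cast congrArg (fun r : ℝ ↦ (r : ℂ)) (norm_canonicalFactor_x₀_sq u)
  rw [liftPairing_apply, ballPairing, map_mul, map_pow]
  calc conj (canonicalFactor u x₀) ^ k * conj (F' (u • x₀)) * (canonicalFactor u x₀ ^ k * F (u • x₀))
      = (conj (canonicalFactor u x₀) * canonicalFactor u x₀) ^ k * (conj (F' (u • x₀)) * F (u • x₀)) := by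
        ring
    _ = (((1 - nsq (u • x₀).1) ^ (3 * k) : ℝ) : ℂ) * (conj (F' (u • x₀)) * F (u • x₀)) := by
        rw [h, pow_mul]; push_cast; ring

/-- `liftPairing k F' F = ballPairing k F' F ∘ (· • x₀)`. [folklore] -/
theorem liftPairing_eq_ballPairing_comp (k : ℕ) (F' F : Ball → ℂ) :
    liftPairing k F' F = ballPairing k F' F ∘ fun u : U21 ↦ u • x₀ :=
  funext (liftPairing_eq_ballPairing k F' F)

/-- **`Δ`-invariance of the density on the ball** for factor forms of the canonical cocycle:
`ballPairing k F' F (δ • z) = ballPairing k F' F z` (`δ ∈ Δ`). [folklore] -/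
theorem ballPairing_smul_of_mem {k : ℕ} {Δ : Subgroup U21} {F' F : Ball → ℂ}
    (hF' : F' ∈ factorForms Δ (canonicalCocycle ℂ k)) (hF : F ∈ factorForms Δ (canonicalCocycle ℂ k))
    {δ : U21} (hδ : δ ∈ Δ) (z : Ball) :
    ballPairing k F' F (δ • z) = ballPairing k F' F z := by
  obtain ⟨u, rfl⟩ := exists_smul_x₀_eq z
  rw [← mul_smul, ← liftPairing_eq_ballPairing, ← liftPairing_eq_ballPairing,
    liftPairing_mul_left (hF' := hF') (hF := hF) (hδ := hδ)]

/-- `z ↦ ‖z‖²` is continuous on the ball. [folklore] -/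
theorem continuous_nsq_val : Continuous fun z : Ball ↦ nsq z.1 := by
  have h : ∀ i : Fin 2, Continuous fun z : Ball ↦ ‖z.1 i‖ ^ 2 := fun i ↦
    (((continuous_apply i).comp continuous_subtype_val).norm).pow 2
  show Continuous fun z : Ball ↦ ‖z.1 0‖ ^ 2 + ‖z.1 1‖ ^ 2
  exact (h 0).add (h 1)

/-- The density is continuous for continuous `F', F`. [folklore] -/
theorem continuous_ballPairing_of_continuous (k : ℕ) {F' F : Ball → ℂ} (hF' : Continuous F')
    (hF : Continuous F) : Continuous (ballPairing k F' F) := by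
  have hc : Continuous fun z : Ball ↦ (((1 - nsq z.1) ^ (3 * k) : ℝ) : ℂ) :=
    Complex.continuous_ofReal.comp ((continuous_const.sub continuous_nsq_val).pow _)
  exact hc.mul ((Complex.continuous_conj.comp hF').mul hF)

/-- The density is continuous for holomorphic `F', F`. [folklore] -/
theorem continuous_ballPairing (k : ℕ) {F' F : Ball → ℂ} (hF' : F' ∈ holomorphic ℂ)
    (hF : F ∈ holomorphic ℂ) : Continuous (ballPairing k F' F) :=
  continuous_ballPairing_of_continuous k (continuous_of_mem_holomorphic hF')
    (continuous_of_mem_holomorphic hF)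

/-- The density is bounded by the product of the sup-type bounds: `‖ballPairing k F' F z‖ ≤ ‖F' z‖ * ‖F z‖`
(as `0 ≤ 1 - ‖z‖² ≤ 1`). [folklore] -/
theorem norm_ballPairing_le (k : ℕ) (F' F : Ball → ℂ) (z : Ball) :
    ‖ballPairing k F' F z‖ ≤ ‖F' z‖ * ‖F z‖ := by
  have h0 : 0 ≤ 1 - nsq z.1 := (one_sub_nsq_pos z).le
  have h1 : 1 - nsq z.1 ≤ 1 := by linarith [nsq_nonneg z.1]
  have hp : (1 - nsq z.1) ^ (3 * k) ≤ 1 := pow_le_one₀ h0 h1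
  rw [ballPairing, norm_mul, norm_mul, Complex.norm_real, Real.norm_of_nonneg (pow_nonneg h0 _),
    Complex.norm_conj]
  calc (1 - nsq z.1) ^ (3 * k) * (‖F' z‖ * ‖F z‖) ≤ 1 * (‖F' z‖ * ‖F z‖) := by gcongr
    _ = ‖F' z‖ * ‖F z‖ := one_mul _

end BallForms

end Literature.AlgebraicGeometry.ShimuraVarieties
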